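import Summits.AnomalousDissipation.AnomalousDissipation.Theorems.SawtoothPulseCascadeK1LocalisedCascadeHalfStepCTCore

/-!
# K1loc, line `Spectral` — helper: THE V HALF-STEP, CORNER-TRACE GRADE (S-D, arbiter A23-13 (2): phases 2–3 are CT)

The twin of `…HalfStepVO.sum_window_sq_norm_vstep_osc_le` in which the tracked part of the input is controlled by the
CORNER-TRACE kernel bound `…CornerTraceSum.cornerTrace_sum_sq_le(_neg)` (input-free: no envelope, no twist cut-off) instead of
the oscillatory sup bound.  V-step `a = b ∘ Φ_V`, `Φ_V = shearMap 1 0 Ψ_j`, integer strain `γ = G`; on the fibre `k₁ = n` the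
tracked input is the trigonometric polynomial `T_n = Σ_{l∈Sχ} χ_l 𝓕b(l,n) e_l(x₀)` (`|l| ≤ L` on `Sχ`), the window satisfies
`|k₀| + L + D ≤ |n|G`, and
  `Σ_{k∈W} |𝓕a(k)|² ≤ (√J_CT + √J_round + √PT)²`,
  `J_CT = 3N σ/π² · 4NΘ + 12N²L²M_c σ/(π²D²) · E`, `σ = 1/(D+L)² + 1/(N(D+L))`,
  `J_round = η²E + 8Mδ_jΘ/π`,
where `Θ` bounds the corner traces `Σ_{n∈F} |T_n(y)|²` uniformly in `y` (supplied by `…TraceInput.sum_sq_trace_le_vfibre`),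
`E ≥ Σ_{n∈F} Σ_l |χ_l 𝓕b(l,n)|²`, `M_c` bounds the residue counts of `Sχ` mod `N_j`, `η ≥ 2π|nG|e^{−M²/2}/(2N_j)` is the
rounding amplitude off the `Mδ_j`-zones (measure `≤ 2Mδ_j/π`), and `PT` is the pass-through term of `…HalfStepVO` verbatim.
-/

-- `Summit.<Summit>.<Problem>`: single-conjunct summit, the duplicate namespace segment is deliberate.
set_option linter.dupNamespace false

namespace Summit.AnomalousDissipation.AnomalousDissipation.Theorems.SawtoothPulseCascade.K1Window

open MeasureTheory Set Filter Topology UnitAddTorus Function Complex Metric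
open scoped Real ENNReal
open Literature.Analysis Literature.Analysis.FunctionSpaces Literature.Analysis.FunctionSpaces.Torus Literature.Analysis.FluidPDE
open Literature.Analysis.FluidPDE.ShearStage
open Literature.Analysis.FluidPDE.SawtoothCascade Literature.Analysis.FluidPDE.SawtoothCascade.CascadeParams
open Summit.AnomalousDissipation.AnomalousDissipation.Theorems.SawtoothPulseCascade.K1Start
open Summit.AnomalousDissipation.AnomalousDissipation.Theorems.SawtoothPulseCascade.K1Flat

/-- The characters of `ℝ/ℤ` at real points: `e_l(↑y) = e^{2πily}`. [folklore] -/
theorem fourier_coe_apply_one (l : ℤ) (y : ℝ) :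
    (fourier l ((y : ℝ) : UnitAddCircle) : ℂ) = cexp (2 * π * I * l * y) := by
  rw [fourier_coe_apply]
  congr 1
  push_cast; ring

set_option maxHeartbeats 400000 in
/-- **THE V HALF-STEP, CORNER-TRACE GRADE** (see the file header).  Data: integer strain `γ = G`, continuous input `b` with
summable coefficients, window `W`, source multiplier `χ` supported in `Sχ ⊂ [−L, L]` with `|χ| ≤ 1`, gap `D ≥ 1` with
`|k₀| + L + D ≤ |k₁|G` on `W`, residue-count bound `M_c`, corner-trace bound `Θ` (all real points `y`), tracked energy bound
`E`, zone parameter `M ≥ 1` with `Mδ_j < π/2`, rounding amplitude `η`.  Conclusion: `Σ_{k∈W}|𝓕(b∘Φ_V)(k)|² ≤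
(√J_CT + √J_round + √PT)²`. [cite: Grafakos2014, Prop. 3.1.2 (5), Prop. 3.2.7 (3)] -/
theorem sum_window_sq_norm_vstep_ct_le (P : CascadeParams) {G : ℕ} (hγ : P.γ = G) (hδ₀ : 0 < P.δ₀) (hd : 0 < P.d)
    (hN₀ : 1 ≤ P.N₀) (hρN : 1 ≤ P.ρN) (j : ℕ)
    {b : UnitAddTorus (Fin 2) → ℂ} (hb : Continuous b) (hbs : Summable fun k => ‖mFourierCoeff b k‖)
    (W : Finset (Fin 2 → ℤ)) (χ : ℤ → ℂ) (Sχ : Finset ℤ) (hχS : ∀ l, l ∉ Sχ → χ l = 0) (hχ1 : ∀ l, ‖χ l‖ ≤ 1)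
    {L D : ℕ} (hSL : ∀ l ∈ Sχ, |l| ≤ L) (hD : 0 < D) (hWD : ∀ k ∈ W, |k 0| + L + D ≤ |k 1| * G)
    {Mc : ℝ} (hMc : ∀ k : ℤ, (((Sχ.filter fun l => (P.N j : ℤ) ∣ k - l).card : ℕ) : ℝ) ≤ Mc)
    {Θ E M η : ℝ} (hΘ : ∀ y : ℝ, ∑ n ∈ W.image (fun k => k 1),
      ‖∑ l ∈ Sχ, χ l * mFourierCoeff b ![l, n] * cexp (2 * π * I * l * y)‖ ^ 2 ≤ Θ)
    (hE : ∑ n ∈ W.image (fun k => k 1), ∑ l ∈ Sχ, ‖χ l * mFourierCoeff b ![l, n]‖ ^ 2 ≤ E)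
    (hM : 1 ≤ M) (hMδ : M * P.δ j < π / 2)
    (hη : ∀ k ∈ W, 2 * π * |((k 1 * G : ℤ) : ℝ)| * (Real.exp (-(M ^ 2 / 2)) / (2 * P.N j)) ≤ η) :
    ∑ k ∈ W, ‖mFourierCoeff (b ∘ shearMap 1 0 (amp ⟨P.U j, P.U_periodic j, P.contDiff_U (P.δ_pos hδ₀ hd j)⟩ P.γ)) k‖ ^ 2 ≤
      (Real.sqrt (3 * P.N j * (1 / ((D : ℝ) + L) ^ 2 + 1 / (P.N j * ((D : ℝ) + L))) / π ^ 2 * (4 * P.N j * Θ) +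
            12 * (P.N j : ℝ) ^ 2 * (L : ℝ) ^ 2 * Mc * (1 / ((D : ℝ) + L) ^ 2 + 1 / (P.N j * ((D : ℝ) + L))) /
              (π ^ 2 * (D : ℝ) ^ 2) * E) +
          Real.sqrt (η ^ 2 * E + 8 * M * P.δ j / π * Θ) +
        Real.sqrt (∑ n ∈ W.image (fun k => k 1), ∫ x : UnitAddTorus (Fin 2),
          ‖∫ s : UnitAddCircle, (fourier (-n) s : ℂ) •
            (b (x + Pi.single (1 : Fin 2) s) - ∑ l ∈ Sχ, χ l * ∫ s' : UnitAddCircle,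
              (fourier (-l) s' : ℂ) • b (x + Pi.single (1 : Fin 2) s + Pi.single (0 : Fin 2) s'))‖ ^ 2)) ^ 2 := by
  classical
  obtain ⟨hπ, h10⟩ : 0 < π ∧ (1 : Fin 2) ≠ 0 := ⟨Real.pi_pos, by decide⟩
  have hN : P.N j ≠ 0 := (N_pos P hN₀ hρN j).ne'
  have hNpos : 0 < P.N j := Nat.pos_of_ne_zero hN
  have hNr : (0 : ℝ) < P.N j := by exact_mod_cast hNpos
  have hI : ∀ {f : UnitAddCircle → ℝ}, Continuous f → Integrable f := fun hf =>
    hf.integrable_of_hasCompactSupport (HasCompactSupport.of_compactSpace _)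
  set Ψ : ShearProfile := amp ⟨P.U j, P.U_periodic j, P.contDiff_U (P.δ_pos hδ₀ hd j)⟩ P.γ with hΨ
  have hΨt : ∀ t : ℝ, Ψ t = P.γ * P.U j t := fun t => amp_apply _ _ _
  -- the input cut-off and its complement
  set T : UnitAddTorus (Fin 2) → ℂ := fun x => ∑ l ∈ Sχ, χ l *
    ∫ s : UnitAddCircle, (fourier (-l) s : ℂ) • b (x + Pi.single (0 : Fin 2) s) with hT
  have hTc : Continuous T := continuous_finsetSum _ fun l _ => continuous_const.mul (continuous_twistedAxisAvg hb 0 l)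
  have hTcoef : ∀ k, mFourierCoeff T k = χ (k 0) * mFourierCoeff b k := fun k => mFourierCoeff_axisCutoff hb 0 hχS k
  have hTs : Summable fun k => ‖mFourierCoeff T k‖ := by
    refine Summable.of_nonneg_of_le (fun k => norm_nonneg _) (fun k => ?_) hbs
    rw [hTcoef k, norm_mul]
    exact mul_le_of_le_one_left (norm_nonneg _) (hχ1 _)
  set θ₂ : UnitAddTorus (Fin 2) → ℂ := fun x => b x - T x with hθ₂
  have hθ₂c : Continuous θ₂ := hb.sub hTc
  have hsum : (fun x => T x + θ₂ x) = b := by funext x; simp [hθ₂]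
  -- the exact chirps and the rounded twists
  set g0 : ℤ → UnitAddCircle → ℂ := fun n => (periodic_exactChirpFun (P.N j) (n * G)).lift with hg0
  have hg0c : ∀ n, Continuous (g0 n) := fun n => (continuous_exactChirp_lift (P.N j) (n * G)).1
  have hg0t : ∀ n (t : ℝ), g0 n (t : UnitAddCircle) =
      Complex.exp (-(2 * π * I * ((n * G : ℤ)) * ((tri (2 * π * P.N j * t) / (2 * π * P.N j) : ℝ) : ℂ))) :=
    fun n t => (continuous_exactChirp_lift (P.N j) (n * G)).2 t
  have hg01 : ∀ n bb, ‖g0 n bb‖ ≤ 1 := by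
    intro n bb
    obtain ⟨t, rfl⟩ := QuotientAddGroup.mk_surjective bb
    rw [hg0t]; exact norm_exp_chirp_le _ _
  have htw1 : ∀ n bb, ‖twist Ψ n bb‖ ≤ 1 := fun n bb => (norm_twist Ψ n bb).le
  have hon : ∀ n (x : UnitAddCircle), ‖twist Ψ n x - g0 n x‖ ≤ 2 := fun n x =>
    (norm_sub_le _ _).trans (by linarith [htw1 n x, hg01 n x])
  -- the rounding remainder off the `Mδ`-zone
  have hround : ∀ k ∈ W, ∀ u : ℝ, (∀ m : ℤ, M * P.δ j < |2 * π * P.N j * u - (π / 2 + π * m)|) →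
      ‖twist Ψ (k 1) ((u : ℝ) : UnitAddCircle) - g0 (k 1) (u : UnitAddCircle)‖ ≤
        2 * π * |((k 1 * G : ℤ) : ℝ)| * (Real.exp (-(M ^ 2 / 2)) / (2 * P.N j)) := by
    intro k _ u hfar2
    have hU := abs_U_sub_tri_le_of_far P hδ₀ hd hN₀ hρN hM hMδ hfar2
    rw [twist_coe, hΨt, hγ, hg0t]
    have e1 : -(2 * ↑π * I * ((k 1 : ℤ) : ℂ) * (((G : ℝ) * P.U j u : ℝ) : ℂ)) =
        -(2 * π * I * (((k 1 * G : ℤ) : ℝ) : ℂ) * ((P.U j u : ℝ) : ℂ)) := by push_cast; ring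
    have e2 : -(2 * ↑π * I * ((k 1 * G : ℤ) : ℂ) * ((tri (2 * π * P.N j * u) / (2 * π * P.N j) : ℝ) : ℂ)) =
        -(2 * π * I * (((k 1 * G : ℤ) : ℝ) : ℂ) * ((tri (2 * π * P.N j * u) / (2 * π * P.N j) : ℝ) : ℂ)) := by
      push_cast; ring
    rw [e1, e2]
    refine (norm_exp_chirp_sub_le _ _ _).trans ?_
    exact mul_le_mul_of_nonneg_left hU (by positivity)
  -- the corner set and the zone set
  set CF : Finset UnitAddCircle := (Finset.Ico (0 : ℤ) (2 * P.N j)).image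
      fun l : ℤ => (((2 * (l : ℝ) + 1) / (4 * P.N j) : ℝ) : UnitAddCircle) with hCF
  have hCFne : CF.Nonempty :=
    Finset.Nonempty.image ⟨0, Finset.mem_Ico.mpr ⟨le_rfl, by exact_mod_cast (by omega : 0 < 2 * P.N j)⟩⟩ _
  have hCFcard : (CF.card : ℝ) ≤ (2 * P.N j : ℕ) := by
    have h1 : CF.card ≤ (Finset.Ico (0 : ℤ) (2 * P.N j)).card := Finset.card_image_le
    rw [Int.card_Ico] at h1
    exact_mod_cast (by omega : CF.card ≤ 2 * P.N j)
  set C : Set UnitAddCircle := (CF : Set UnitAddCircle) with hC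
  set rM : ℝ := M * P.δ j / (2 * π * P.N j) with hrM
  have hM0 : (0 : ℝ) ≤ M := by linarith
  have hrM0 : 0 ≤ rM := by have := (P.δ_pos hδ₀ hd j).le; positivity
  set Z : Set UnitAddCircle := {x | infDist x C ≤ rM} with hZ
  have hZm : MeasurableSet Z := (isClosed_le (continuous_infDist_pt C) continuous_const).measurableSet
  have hZsub : Z ⊆ ⋃ c ∈ CF, Metric.closedBall c rM := by
    intro x hx; rw [hZ, Set.mem_setOf_eq] at hx
    have hCc : IsCompact C := by rw [hC]; exact CF.finite_toSet.isCompact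
    have hCne : C.Nonempty := by rw [hC]; exact_mod_cast hCFne
    obtain ⟨c, hc, hcd⟩ := hCc.exists_infDist_eq_dist hCne x
    rw [hC] at hc; refine Set.mem_iUnion₂.mpr ⟨c, by exact_mod_cast hc, ?_⟩
    rw [Metric.mem_closedBall, ← hcd]; exact hx
  have hZvol : volume.real Z ≤ (2 * P.N j : ℕ) * (2 * rM) := by
    refine (measureReal_mono hZsub (measure_ne_top _ _)).trans ((measureReal_biUnion_finset_le CF _).trans ?_)
    have hball : ∀ c ∈ CF, volume.real (Metric.closedBall c rM) ≤ 2 * rM := by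
      intro c _
      rw [Measure.real, AddCircle.volume_closedBall, ENNReal.toReal_ofReal (le_min zero_le_one (by linarith))]
      exact min_le_right _ _
    refine (Finset.sum_le_sum hball).trans ?_
    rw [Finset.sum_const, nsmul_eq_mul]; exact mul_le_mul_of_nonneg_right hCFcard (by linarith)
  have hr2 : ((2 * P.N j : ℕ) : ℝ) * (2 * rM) = 2 * M * P.δ j / π := by
    rw [hrM]; push_cast; field_simp
  -- off the zones the rounded twist is `η`-close to the exact chirp
  have hoffZ : ∀ k ∈ W, ∀ x, x ∉ Z → ‖twist Ψ (k 1) x - g0 (k 1) x‖ ≤ η := by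
    intro k hk x hx; rw [hZ, Set.mem_setOf_eq, not_le] at hx
    obtain ⟨u, rfl⟩ := QuotientAddGroup.mk_surjective x
    have e : (QuotientAddGroup.mk u : UnitAddCircle) = ((u : ℝ) : UnitAddCircle) := rfl
    rw [e] at hx ⊢
    refine (hround k hk u fun m => ?_).trans (hη k hk)
    have hph := phase_far_of_le_infDist hNpos (le_refl (infDist ((u : ℝ) : UnitAddCircle) C)) m
    have : M * P.δ j < 2 * π * P.N j * infDist ((u : ℝ) : UnitAddCircle) C := by
      rw [hrM, div_lt_iff₀ (by positivity)] at hx; linarith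
    linarith
  -- fibres of the window
  set F : Finset ℤ := W.image fun k => k 1 with hF
  have hmaps : ∀ k ∈ W, k 1 ∈ F := fun k hk => Finset.mem_image_of_mem _ hk
  obtain ⟨Wn, hWn⟩ : ∃ Wn : ℤ → Finset ℤ, ∀ n, Wn n = (W.filter fun k => k 1 = n).image fun k => k 0 :=
    ⟨_, fun _ => rfl⟩
  have hWn' : ∀ n, ∀ k₀ ∈ Wn n, ∃ k ∈ W, k 1 = n ∧ k 0 = k₀ := by
    intro n k₀ hk₀; rw [hWn] at hk₀
    obtain ⟨k, hk, rfl⟩ := Finset.mem_image.mp hk₀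
    obtain ⟨hkW, hkn⟩ := Finset.mem_filter.mp hk
    exact ⟨k, hkW, hkn, rfl⟩
  have hFW : ∀ n ∈ F, ∃ k ∈ W, k 1 = n := fun n hn => by
    obtain ⟨k, hk, rfl⟩ := Finset.mem_image.mp hn
    exact ⟨k, hk, rfl⟩
  have hnG : ∀ n : ℤ, ((n.natAbs * G : ℕ) : ℤ) = |n| * G := fun n => by rw [Nat.cast_mul, Int.natCast_natAbs]
  -- (1) the coefficient identity on a fibre
  have hcoefT : ∀ k ∈ W, mFourierCoeff (T ∘ shearMap 1 0 Ψ) k =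
      fourierCoeff (fun x : UnitAddCircle => twist Ψ (k 1) x *
        ∑ l ∈ Sχ, χ l * mFourierCoeff b ![l, k 1] * fourier l x) (k 0) := by
    intro k _
    rw [mFourierCoeff_comp_shearMap hTc hTs h10 Ψ k, fourierCoeff_mul_trigPoly (continuous_twist Ψ _) _ Sχ (k 0)]
    have hzero : ∀ m : ℤ, m ∉ Sχ.image (fun l => k 0 - l) →
        fourierCoeff (twist Ψ (k 1)) m * mFourierCoeff T (k - Pi.single 0 m) = 0 := by
      intro m hm
      rw [hTcoef]
      have e0 : (k - Pi.single (0 : Fin 2) m : Fin 2 → ℤ) 0 = k 0 - m := by simp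
      have hnot : k 0 - m ∉ Sχ := fun hmem => hm (Finset.mem_image.mpr ⟨k 0 - m, hmem, by ring⟩)
      rw [e0, hχS _ hnot, zero_mul, mul_zero]
    rw [tsum_eq_sum (s := Sχ.image fun l => k 0 - l) hzero,
      Finset.sum_image fun l _ l' _ h => by linarith]
    refine Finset.sum_congr rfl fun l _ => ?_
    have e2 : k - Pi.single (0 : Fin 2) (k 0 - l) = ![l, k 1] := by
      funext i; fin_cases i <;> simp
    rw [hTcoef, e2]; simp only [Matrix.cons_val_zero]; ring
  -- (2) the window, fibre by fibre
  have hTsum : ∑ k ∈ W, ‖mFourierCoeff (T ∘ shearMap 1 0 Ψ) k‖ ^ 2 =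
      ∑ n ∈ F, ∑ k₀ ∈ Wn n, ‖fourierCoeff (fun x : UnitAddCircle => twist Ψ n x *
        ∑ l ∈ Sχ, χ l * mFourierCoeff b ![l, n] * fourier l x) k₀‖ ^ 2 := by
    rw [← Finset.sum_fiberwise_of_maps_to hmaps]
    refine Finset.sum_congr rfl fun n _ => ?_
    rw [hWn n, Finset.sum_image ?_]
    · refine Finset.sum_congr rfl fun k hk => ?_
      obtain ⟨hkW, hkn⟩ := Finset.mem_filter.mp hk
      rw [hcoefT k hkW, hkn]
    · intro k hk k' hk' h
      obtain ⟨-, h1⟩ := Finset.mem_filter.mp (Finset.mem_coe.mp hk)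
      obtain ⟨-, h1'⟩ := Finset.mem_filter.mp (Finset.mem_coe.mp hk')
      funext i; fin_cases i; exacts [h, h1.trans h1'.symm]
  -- (3) abbreviations for the per-fibre quantities
  obtain ⟨e, he⟩ : ∃ e : ℤ → ℝ, ∀ n, e n = ∑ l ∈ Sχ, ‖χ l * mFourierCoeff b ![l, n]‖ ^ 2 := ⟨_, fun n => rfl⟩
  obtain ⟨pos, hpos⟩ : ∃ pos : ℤ → ℝ, ∀ n, pos n =
      ∑ r ∈ Finset.range (P.N j), ‖∑ l ∈ Sχ, χ l * mFourierCoeff b ![l, n] *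
          cexp (2 * π * I * l * ((4 * (r : ℝ) - 1) / (4 * P.N j)))‖ ^ 2 +
        ∑ r ∈ Finset.range (P.N j), ‖∑ l ∈ Sχ, χ l * mFourierCoeff b ![l, n] *
          cexp (2 * π * I * l * ((4 * (r : ℝ) + 1) / (4 * P.N j)))‖ ^ 2 := ⟨_, fun n => rfl⟩
  obtain ⟨neg, hneg⟩ : ∃ neg : ℤ → ℝ, ∀ n, neg n =
      ∑ r ∈ Finset.range (P.N j), ‖∑ l ∈ Sχ, χ l * mFourierCoeff b ![l, n] *
          cexp (2 * π * I * l * (-((4 * (r : ℝ) - 1) / (4 * P.N j))))‖ ^ 2 +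
        ∑ r ∈ Finset.range (P.N j), ‖∑ l ∈ Sχ, χ l * mFourierCoeff b ![l, n] *
          cexp (2 * π * I * l * (-((4 * (r : ℝ) + 1) / (4 * P.N j))))‖ ^ 2 := ⟨_, fun n => rfl⟩
  obtain ⟨ρ, hρ⟩ : ∃ ρ : ℤ → ℝ, ∀ n, ρ n =
      ∫ x in Z, ‖∑ l ∈ Sχ, χ l * mFourierCoeff b ![l, n] * (fourier l x : ℂ)‖ ^ 2 := ⟨_, fun n => rfl⟩
  obtain ⟨c₁, hc₁⟩ : ∃ c₁ : ℝ, c₁ =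
      3 * P.N j * (1 / ((D : ℝ) + L) ^ 2 + 1 / (P.N j * ((D : ℝ) + L))) / π ^ 2 := ⟨_, rfl⟩
  obtain ⟨c₂, hc₂⟩ : ∃ c₂ : ℝ, c₂ = 12 * (P.N j : ℝ) ^ 2 * (L : ℝ) ^ 2 * Mc *
      (1 / ((D : ℝ) + L) ^ 2 + 1 / (P.N j * ((D : ℝ) + L))) / (π ^ 2 * (D : ℝ) ^ 2) := ⟨_, rfl⟩
  have hMc0 : 0 ≤ Mc := le_trans (Nat.cast_nonneg _) (hMc 0)
  have hc₁0 : 0 ≤ c₁ := by rw [hc₁]; positivity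
  have hc₂0 : 0 ≤ c₂ := by rw [hc₂]; positivity
  have he0 : ∀ n, 0 ≤ e n := fun n => by rw [he]; positivity
  have hpos0 : ∀ n, 0 ≤ pos n := fun n => by rw [hpos]; positivity
  have hneg0 : ∀ n, 0 ≤ neg n := fun n => by rw [hneg]; positivity
  have hρ0 : ∀ n, 0 ≤ ρ n := fun n => by rw [hρ]; exact integral_nonneg fun x => sq_nonneg _
  have hΘ0 : 0 ≤ Θ := le_trans (Finset.sum_nonneg fun n _ => sq_nonneg _) (hΘ 0)
  -- (4) the corner-trace bound on each fibre
  have hXn : ∀ n ∈ F, ∑ k₀ ∈ Wn n, ‖∑ l ∈ Sχ, χ l * mFourierCoeff b ![l, n] * fourierCoeff (g0 n) (k₀ - l)‖ ^ 2 ≤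
      c₁ * (pos n + neg n) + c₂ * e n := by
    intro n hn
    obtain ⟨k, hkW, hkn⟩ := hFW n hn
    have hWn2 : ∀ k₀ ∈ Wn n, |k₀| + L + D ≤ (((n.natAbs * G : ℕ) : ℤ)) := by
      intro k₀ hk₀
      obtain ⟨k', hk'W, hk'n, rfl⟩ := hWn' n k₀ hk₀
      rw [hnG, ← hk'n]; exact hWD k' hk'W
    rcases lt_trichotomy n 0 with hlt | hzero | hgt
    · have hcast : -(((n.natAbs * G : ℕ) : ℤ)) = n * G := by rw [hnG, abs_of_neg hlt]; ring
      have hg₀' : ∀ t : ℝ, g0 n (t : UnitAddCircle) = Complex.exp (-(2 * π * I * ((-(((n.natAbs * G : ℕ) : ℤ)) : ℤ) : ℂ) *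
          ((tri (2 * π * P.N j * t) / (2 * π * P.N j) : ℝ) : ℂ))) := fun t => by rw [hg0t, hcast]
      have h := cornerTrace_sum_sq_le_neg hNpos hg₀' (fun l => χ l * mFourierCoeff b ![l, n]) Sχ hD hSL hMc (Wn n) hWn2
      beta_reduce at h
      rw [← hc₁, ← hc₂, ← he n, ← hneg n] at h
      have : c₁ * neg n ≤ c₁ * (pos n + neg n) := mul_le_mul_of_nonneg_left (le_add_of_nonneg_left (hpos0 n)) hc₁0
      linarith
    · exfalso
      have hkD := hWD k hkW
      rw [hkn, hzero, abs_zero, zero_mul] at hkD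
      have hD1 : (1 : ℤ) ≤ D := by exact_mod_cast hD
      linarith [abs_nonneg (k 0)]
    · have hcast : (((n.natAbs * G : ℕ) : ℤ)) = n * G := by rw [hnG, abs_of_pos hgt]
      have hg₀' : ∀ t : ℝ, g0 n (t : UnitAddCircle) = Complex.exp (-(2 * π * I * ((((n.natAbs * G : ℕ) : ℤ)) : ℂ) *
          ((tri (2 * π * P.N j * t) / (2 * π * P.N j) : ℝ) : ℂ))) := fun t => by rw [hg0t, hcast]
      have h := cornerTrace_sum_sq_le hNpos hg₀' (fun l => χ l * mFourierCoeff b ![l, n]) Sχ hD hSL hMc (Wn n) hWn2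
      beta_reduce at h
      rw [← hc₁, ← hc₂, ← he n, ← hpos n] at h
      have : c₁ * pos n ≤ c₁ * (pos n + neg n) := mul_le_mul_of_nonneg_left (le_add_of_nonneg_right (hneg0 n)) hc₁0
      linarith
  -- (5) the CT half-step on each fibre
  have hfib : ∀ n ∈ F, ∑ k₀ ∈ Wn n, ‖fourierCoeff (fun x : UnitAddCircle => twist Ψ n x *
        ∑ l ∈ Sχ, χ l * mFourierCoeff b ![l, n] * fourier l x) k₀‖ ^ 2 ≤
      (Real.sqrt (c₁ * (pos n + neg n) + c₂ * e n) + Real.sqrt (η ^ 2 * e n + 4 * ρ n)) ^ 2 := by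
    intro n hn
    obtain ⟨k, hkW, hkn⟩ := hFW n hn
    have h := sum_window_sq_norm_fourierCoeff_mul_trigPoly_le (continuous_twist Ψ n) (hg0c n)
      (fun l => χ l * mFourierCoeff b ![l, n]) Sχ (Wn n) (hXn n hn) hZm
      (fun x hx => by rw [← hkn]; exact hoffZ k hkW x hx) (hon n)
    beta_reduce at h
    rw [← he n, ← hρ n] at h
    exact h
  -- (6) the sums over the fibres
  have hpt : ∀ (y : ℝ) (w : ℂ), (y : ℂ) = w →
      ∑ n ∈ F, ‖∑ l ∈ Sχ, χ l * mFourierCoeff b ![l, n] * cexp (2 * π * I * l * w)‖ ^ 2 ≤ Θ := by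
    intro y w h; subst h; exact hΘ y
  have hsw : ∀ w : ℕ → ℂ, (∀ r, ∃ y : ℝ, (y : ℂ) = w r) → ∑ n ∈ F, ∑ r ∈ Finset.range (P.N j),
      ‖∑ l ∈ Sχ, χ l * mFourierCoeff b ![l, n] * cexp (2 * π * I * l * w r)‖ ^ 2 ≤ P.N j * Θ := by
    intro w hw; rw [Finset.sum_comm]
    calc ∑ r ∈ Finset.range (P.N j), ∑ n ∈ F, ‖∑ l ∈ Sχ, χ l * mFourierCoeff b ![l, n] * cexp (2 * π * I * l * w r)‖ ^ 2
        ≤ ∑ r ∈ Finset.range (P.N j), Θ :=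
          Finset.sum_le_sum fun r _ => by obtain ⟨y, hy⟩ := hw r; exact hpt y _ hy
      _ = P.N j * Θ := by rw [Finset.sum_const, Finset.card_range, nsmul_eq_mul]
  have hposF : ∑ n ∈ F, pos n ≤ 2 * (P.N j * Θ) := by
    simp only [hpos, Finset.sum_add_distrib]
    have h1 := hsw (fun r => ((4 * (r : ℝ) - 1) / (4 * P.N j) : ℂ))
      (fun r => ⟨(4 * (r : ℝ) - 1) / (4 * P.N j), by push_cast; ring⟩)
    have h2 := hsw (fun r => ((4 * (r : ℝ) + 1) / (4 * P.N j) : ℂ))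
      (fun r => ⟨(4 * (r : ℝ) + 1) / (4 * P.N j), by push_cast; ring⟩)
    beta_reduce at h1 h2; linarith
  have hnegF : ∑ n ∈ F, neg n ≤ 2 * (P.N j * Θ) := by
    simp only [hneg, Finset.sum_add_distrib]
    have h1 := hsw (fun r => (-((4 * (r : ℝ) - 1) / (4 * P.N j)) : ℂ))
      (fun r => ⟨-((4 * (r : ℝ) - 1) / (4 * P.N j)), by push_cast; ring⟩)
    have h2 := hsw (fun r => (-((4 * (r : ℝ) + 1) / (4 * P.N j)) : ℂ))
      (fun r => ⟨-((4 * (r : ℝ) + 1) / (4 * P.N j)), by push_cast; ring⟩)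
    beta_reduce at h1 h2; linarith
  have heF : ∑ n ∈ F, e n ≤ E := by simp only [he]; exact hE
  have hρF : ∑ n ∈ F, ρ n ≤ 2 * M * P.δ j / π * Θ := by
    simp only [hρ]
    have hint : ∀ n ∈ F, Integrable (fun x : UnitAddCircle =>
        ‖∑ l ∈ Sχ, χ l * mFourierCoeff b ![l, n] * (fourier l x : ℂ)‖ ^ 2) (volume.restrict Z) := fun n _ =>
      (hI ((continuous_norm.comp (continuous_finsetSum _ fun l _ =>
        continuous_const.mul (fourier l).continuous)).pow 2)).restrict
    rw [← integral_finsetSum F hint]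
    have hle : ∀ x ∈ Z, ‖∑ n ∈ F, ‖∑ l ∈ Sχ, χ l * mFourierCoeff b ![l, n] * (fourier l x : ℂ)‖ ^ 2‖ ≤ Θ := by
      intro x _
      obtain ⟨y, rfl⟩ := QuotientAddGroup.mk_surjective x
      have ey : (QuotientAddGroup.mk y : UnitAddCircle) = ((y : ℝ) : UnitAddCircle) := rfl
      rw [ey, Real.norm_of_nonneg (Finset.sum_nonneg fun n _ => sq_nonneg _)]
      simp only [fourier_coe_apply_one]
      exact hΘ y
    have h := norm_setIntegral_le_of_norm_le_const (measure_lt_top volume Z) hle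
    refine ((le_abs_self _).trans ((Real.norm_eq_abs _).symm.le.trans h)).trans ?_
    calc Θ * volume.real Z ≤ Θ * (((2 * P.N j : ℕ) : ℝ) * (2 * rM)) := mul_le_mul_of_nonneg_left hZvol hΘ0
      _ = 2 * M * P.δ j / π * Θ := by rw [hr2]; ring
  -- (7) the tracked part
  have hA : ∑ n ∈ F, (c₁ * (pos n + neg n) + c₂ * e n) ≤ c₁ * (4 * P.N j * Θ) + c₂ * E := by
    rw [Finset.sum_add_distrib, ← Finset.mul_sum, ← Finset.mul_sum, Finset.sum_add_distrib]
    have h1 : c₁ * (∑ n ∈ F, pos n + ∑ n ∈ F, neg n) ≤ c₁ * (4 * P.N j * Θ) :=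
      mul_le_mul_of_nonneg_left (by linarith) hc₁0
    have h2 : c₂ * ∑ n ∈ F, e n ≤ c₂ * E := mul_le_mul_of_nonneg_left heF hc₂0
    linarith
  have hB : ∑ n ∈ F, (η ^ 2 * e n + 4 * ρ n) ≤ η ^ 2 * E + 8 * M * P.δ j / π * Θ := by
    rw [Finset.sum_add_distrib, ← Finset.mul_sum, ← Finset.mul_sum]
    have h1 : η ^ 2 * ∑ n ∈ F, e n ≤ η ^ 2 * E := mul_le_mul_of_nonneg_left heF (sq_nonneg _)
    have h2 : 4 * ∑ n ∈ F, ρ n ≤ 4 * (2 * M * P.δ j / π * Θ) := by linarith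
    have h3 : 4 * (2 * M * P.δ j / π * Θ) = 8 * M * P.δ j / π * Θ := by ring
    linarith
  have hTpart : ∑ k ∈ W, ‖mFourierCoeff (T ∘ shearMap 1 0 Ψ) k‖ ^ 2 ≤
      (Real.sqrt (c₁ * (4 * P.N j * Θ) + c₂ * E) + Real.sqrt (η ^ 2 * E + 8 * M * P.δ j / π * Θ)) ^ 2 := by
    rw [hTsum]
    have h1 := Finset.sum_le_sum hfib
    have h2 := SpectralLeakage.sqrt_sum_add_sq_le F (a := fun n => Real.sqrt (c₁ * (pos n + neg n) + c₂ * e n))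
      (b := fun n => Real.sqrt (η ^ 2 * e n + 4 * ρ n)) (fun n _ => Real.sqrt_nonneg _) (fun n _ => Real.sqrt_nonneg _)
    have h3 : ∑ n ∈ F, Real.sqrt (c₁ * (pos n + neg n) + c₂ * e n) ^ 2 = ∑ n ∈ F, (c₁ * (pos n + neg n) + c₂ * e n) :=
      Finset.sum_congr rfl fun n _ => Real.sq_sqrt (by
        have := hpos0 n; have := hneg0 n; have := he0 n; positivity)
    have h4 : ∑ n ∈ F, Real.sqrt (η ^ 2 * e n + 4 * ρ n) ^ 2 = ∑ n ∈ F, (η ^ 2 * e n + 4 * ρ n) :=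
      Finset.sum_congr rfl fun n _ => Real.sq_sqrt (by have := he0 n; have := hρ0 n; positivity)
    rw [h3, h4] at h2
    have h0 : 0 ≤ ∑ n ∈ F, (Real.sqrt (c₁ * (pos n + neg n) + c₂ * e n) + Real.sqrt (η ^ 2 * e n + 4 * ρ n)) ^ 2 :=
      Finset.sum_nonneg fun n _ => sq_nonneg _
    calc _ ≤ _ := h1
      _ = (Real.sqrt (∑ n ∈ F, (Real.sqrt (c₁ * (pos n + neg n) + c₂ * e n) +
            Real.sqrt (η ^ 2 * e n + 4 * ρ n)) ^ 2)) ^ 2 := (Real.sq_sqrt h0).symm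
      _ ≤ (Real.sqrt (∑ n ∈ F, (c₁ * (pos n + neg n) + c₂ * e n)) +
            Real.sqrt (∑ n ∈ F, (η ^ 2 * e n + 4 * ρ n))) ^ 2 := pow_le_pow_left₀ (Real.sqrt_nonneg _) h2 2
      _ ≤ _ := pow_le_pow_left₀ (by positivity)
            (add_le_add (Real.sqrt_le_sqrt hA) (Real.sqrt_le_sqrt hB)) 2
  -- (8) the pass-through part and the assembly
  set H₂ : ℤ → UnitAddTorus (Fin 2) → ℂ := fun n x => twist Ψ n (x 0) *
    ∫ s : UnitAddCircle, (fourier (-n) s : ℂ) • θ₂ (x + Pi.single (1 : Fin 2) s) with hH₂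
  have hH₂c : ∀ n, Continuous (H₂ n) := fun n =>
    ((continuous_twist Ψ n).comp (continuous_apply 0)).mul (continuous_twistedAxisAvg hθ₂c 1 n)
  have hcoef : ∀ k ∈ W, mFourierCoeff ((fun x => T x + θ₂ x) ∘ shearMap 1 0 Ψ) k =
      mFourierCoeff (T ∘ shearMap 1 0 Ψ) k + mFourierCoeff (H₂ (k 1)) k := by
    intro k _
    have hs : ((fun x => T x + θ₂ x) ∘ shearMap 1 0 Ψ) = (T ∘ shearMap 1 0 Ψ) + (θ₂ ∘ shearMap 1 0 Ψ) := rfl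
    rw [hs, Torus.mFourierCoeff_add (F := ℂ) ((hTc.comp (continuous_shearMap 1 0 Ψ)).integrable_unitAddTorus)
      ((hθ₂c.comp (continuous_shearMap 1 0 Ψ)).integrable_unitAddTorus),
      mFourierCoeff_comp_shearMap_eq_chirp hθ₂c h10 Ψ k]
  have hMk : ∑ k ∈ W, ‖mFourierCoeff ((fun x => T x + θ₂ x) ∘ shearMap 1 0 Ψ) k‖ ^ 2 ≤
      (Real.sqrt (∑ k ∈ W, ‖mFourierCoeff (T ∘ shearMap 1 0 Ψ) k‖ ^ 2) +
        Real.sqrt (∑ k ∈ W, ‖mFourierCoeff (H₂ (k 1)) k‖ ^ 2)) ^ 2 := by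
    have h1 : ∑ k ∈ W, ‖mFourierCoeff ((fun x => T x + θ₂ x) ∘ shearMap 1 0 Ψ) k‖ ^ 2 ≤
        ∑ k ∈ W, (‖mFourierCoeff (T ∘ shearMap 1 0 Ψ) k‖ + ‖mFourierCoeff (H₂ (k 1)) k‖) ^ 2 := by
      refine Finset.sum_le_sum fun k hk => ?_
      rw [hcoef k hk]
      exact pow_le_pow_left₀ (norm_nonneg _) (norm_add_le _ _) 2
    have h2 := SpectralLeakage.sqrt_sum_add_sq_le W (a := fun k => ‖mFourierCoeff (T ∘ shearMap 1 0 Ψ) k‖)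
      (b := fun k => ‖mFourierCoeff (H₂ (k 1)) k‖) (fun k _ => norm_nonneg _) (fun k _ => norm_nonneg _)
    have h0 : 0 ≤ ∑ k ∈ W, (‖mFourierCoeff (T ∘ shearMap 1 0 Ψ) k‖ + ‖mFourierCoeff (H₂ (k 1)) k‖) ^ 2 :=
      Finset.sum_nonneg fun k _ => sq_nonneg _
    calc _ ≤ _ := h1
      _ = (Real.sqrt (∑ k ∈ W, (‖mFourierCoeff (T ∘ shearMap 1 0 Ψ) k‖ + ‖mFourierCoeff (H₂ (k 1)) k‖) ^ 2)) ^ 2 :=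
          (Real.sq_sqrt h0).symm
      _ ≤ _ := pow_le_pow_left₀ (Real.sqrt_nonneg _) h2 2
  have hPT : ∑ k ∈ W, ‖mFourierCoeff (H₂ (k 1)) k‖ ^ 2 ≤ ∑ n ∈ F,
      ∫ x : UnitAddTorus (Fin 2), ‖∫ s : UnitAddCircle, (fourier (-n) s : ℂ) • θ₂ (x + Pi.single (1 : Fin 2) s)‖ ^ 2 := by
    rw [← Finset.sum_fiberwise_of_maps_to hmaps]
    refine Finset.sum_le_sum fun n _ => ?_
    calc ∑ k ∈ W with k 1 = n, ‖mFourierCoeff (H₂ (k 1)) k‖ ^ 2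
        = ∑ k ∈ W with k 1 = n, ‖mFourierCoeff (H₂ n) k‖ ^ 2 :=
          Finset.sum_congr rfl fun k hk => by rw [(Finset.mem_filter.mp hk).2]
      _ ≤ ∫ x : UnitAddTorus (Fin 2), ‖H₂ n x‖ ^ 2 := sum_sq_norm_mFourierCoeff_le_integral (hH₂c n) _
      _ = ∫ x : UnitAddTorus (Fin 2), ‖∫ s : UnitAddCircle, (fourier (-n) s : ℂ) • θ₂ (x + Pi.single (1 : Fin 2) s)‖ ^ 2 :=
          integral_congr_ae (Eventually.of_forall fun x => by simp only [hH₂, norm_mul, norm_twist, one_mul])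
  have hTsqrt : Real.sqrt (∑ k ∈ W, ‖mFourierCoeff (T ∘ shearMap 1 0 Ψ) k‖ ^ 2) ≤
      Real.sqrt (c₁ * (4 * P.N j * Θ) + c₂ * E) + Real.sqrt (η ^ 2 * E + 8 * M * P.δ j / π * Θ) :=
    (Real.sqrt_le_sqrt hTpart).trans (by rw [Real.sqrt_sq (by positivity)])
  rw [hsum] at hMk
  refine hMk.trans (pow_le_pow_left₀ (add_nonneg (Real.sqrt_nonneg _) (Real.sqrt_nonneg _))
    (add_le_add ?_ (Real.sqrt_le_sqrt hPT)) 2)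
  rw [hc₁, hc₂] at hTsqrt; exact hTsqrt

end Summit.AnomalousDissipation.AnomalousDissipation.Theorems.SawtoothPulseCascade.K1Window
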